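import Literature.AlgebraicGeometry.ShimuraVarieties.UnitaryShimuraReciprocityFactorGlobal
import Literature.AlgebraicGeometry.ShimuraVarieties.UnitaryShimuraCurveRecord
import Literature.AlgebraicGeometry.ShimuraVarieties.UnitaryGroupDiagonalTwistExists
import HarnessLib

/-!
# The reciprocity twist `[τw, r(s)·aK]` on the unitary Shimura CURVE is independent of the Artin correspondent `s`
# ([Milne 2005] Def. 12.8 (62), rank-2 copy of `UnitaryShimuraReciprocityTwistInvariance`)

Topic `AlgebraicGeometry/ShimuraVarieties`; namespace `Literature.AlgebraicGeometry.ShimuraVarieties.UnitaryCanonicalModel`.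
THEOREMS ONLY (no definition, no named fact, no instance, no `sorry`; net Literature debt 0).  Cell `hodgecm-mathlib` (D-0151),
FLOOR 0, P6 «MOD programme», door (E) of `stub_RGD`, organ E3R (special-pair reciprocity `f_recip` of the chart `AuxChartGS`),
FILE D: the rank-`2`, cone-coordinate copy (`ShimuraSetGS`, `IsDiagTwistGS`, `adelicVecFin` of ★ `UnitaryShimuraCurveRecord`) of
★ `UnitaryShimuraReciprocityTwistInvariance` §4–§5 (rank `3`, ball model), over the rank-free §1–§3 of
★ `UnitaryShimuraReciprocityFactorGlobal` (reused BY NAME).  `--supports stmt-HodgeConjecture-24832`, count-neutral; HC_CM is proved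
only modulo the printed citations until rung 0 closes.

WHAT IS PROVED (`L` CM with complex conjugation `c`, `J⋆ ∈ M₂(L)` with `c(J⋆ᵢⱼ) = J⋆ⱼᵢ`, `w ∈ L²` anisotropic, `τ : L → ℂ`):
* §1 `isDiagTwistGS_unique` — a diagonal twist at `w` (★ `IsDiagTwistGS`: `d·(w ⊗ 1) = t·(w ⊗ 1)`, `d = 1` on `w^⊥`) is determined
  by its eigenvalue `t` (the `L`-span of `w` and `w^⊥` is `L²`); `IsDiagTwistGS.mul_inv` — `d·d'⁻¹` is the twist by `t·t''` when
  `t'·t'' = 1`.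
* §2 `exists_rational_isDiagTwistGS_algebraMap` — for `z ∈ L` with `z·c(z) = 1` the quasi-reflection
  `γ_z = 1 + ((z−1)/⟨w,w⟩)·w ⊗ ⟨w,·⟩` lies in `U(J⋆)(L⁺)` (the tree's `rational`), its image in `U(J⋆)(𝔸_{L⁺,f})` is THE diagonal
  twist by `z ⊗ 1`, and `γ_z^τ (τw) = τ(z)·(τw)` — [Milne2005ShimuraVarieties] Def. 12.5: the special point `[τw]` is fixed by
  `T(ℚ) ∋ γ_z`; `shimuraSetGS_mk_mul_eq_of_isDiagTwistGS_algebraMap` — hence `[τw, g·aK] = [τw, aK]` for the twist `g` by a global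
  norm-one `z`, at EVERY level `K`.
* §3 **`shimuraSetGS_mk_twist_eq_of_isArtinCorrespondent`** — if `s, s'` are both Artin correspondents of `σ` over `(L, τ)`
  (★ `IsArtinCorrespondent`) and `d, d'` the diagonal twists at `w` by `r(s) = c(s)/s`, `r(s') = c(s')/s'` (★ `recipFactor`), then
  `[τw, d·aK] = [τw, d'·aK]` in `Sh_K(U(J⋆), 𝔻)(ℂ)` for all `a`, `K`: `r(s)/r(s') = z ⊗ 1` is a GLOBAL norm-one scalar
  (★ `exists_recipFactor_eq_algebraMap_of_mem_closure`, Kronecker) and §2 applies.  So the reciprocity law (62) on the curve is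
  well posed, and a law proved for ONE correspondent (e.g. `N_{E♯/L} s♯` coming from Siegel reciprocity at the special pair)
  holds for ALL (e.g. the `L`-idèle `s` of the chart's `f_recip`).

## References
* [CasselsFrohlichANT1967] J. W. S. Cassels, A. Fröhlich (eds.), *Algebraic Number Theory* (1967), Ch. II §14 (adèles of a vector space).
* [Milne2005ShimuraVarieties] J. S. Milne, *Introduction to Shimura varieties* (2005), Lemma 5.13 p. 57, Def. 12.5–Rem. 12.6
  p. 113, Def. 12.8 (62) p. 114.
* [Shimura1998] G. Shimura, *Abelian Varieties with Complex Multiplication and Modular Functions* (1998), §18.3 p. 122.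
* [Deligne1979ShimuraVarieties] P. Deligne, *Variétés de Shimura* (1979), 2.2.4–2.2.5.
-/

set_option autoImplicit false

noncomputable section

open Function NumberField IsDedekindDomain Matrix
open scoped Matrix
open Literature.NumberTheory.Automorphic Literature.NumberTheory.Automorphic.UnitaryGroup
open Literature.NumberTheory.GaloisRepresentations
open Literature.NumberTheory.NumberFields

namespace Literature.AlgebraicGeometry.ShimuraVarieties

namespace UnitaryCanonicalModel

variable (L : Type) [Field L] [NumberField L] [IsCMField L]

/-! ### §0. Bookkeeping on `adelicVecFin` and the hermitian pairing -/

omit [IsCMField L] in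
/-- `(x - y) ⊗ 1 = x ⊗ 1 - y ⊗ 1` for the diagonal embedding `Lⁿ → (𝔸_{L,f})ⁿ`. [cite: CasselsFrohlichANT1967, Ch. II §14] -/
theorem adelicVecFin_sub {n : ℕ} (x y : Fin n → L) : adelicVecFin L (x - y) = adelicVecFin L x - adelicVecFin L y := by
  funext i
  simp [adelicVecFin]

omit [IsCMField L] in
/-- `(a • x) ⊗ 1 = (a ⊗ 1) • (x ⊗ 1)` for the diagonal embedding `Lⁿ → (𝔸_{L,f})ⁿ`. [cite: CasselsFrohlichANT1967, Ch. II §14] -/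
theorem adelicVecFin_smul {n : ℕ} (a : L) (x : Fin n → L) :
    adelicVecFin L (a • x) = algebraMap L (FiniteAdeleRing (𝓞 L) L) a • adelicVecFin L x := by
  funext i
  simp [adelicVecFin]

omit [IsCMField L] in
/-- `e_j ⊗ 1 = e_j` for the diagonal embedding `Lⁿ → (𝔸_{L,f})ⁿ`. [cite: CasselsFrohlichANT1967, Ch. II §14] -/
theorem adelicVecFin_single {n : ℕ} (j : Fin n) :
    adelicVecFin L (Pi.single j (1 : L)) = Pi.single j (1 : FiniteAdeleRing (𝓞 L) L) := by
  funext i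
  by_cases h : i = j
  · subst h; simp [adelicVecFin]
  · simp [adelicVecFin, h]

omit [IsCMField L] in
/-- A rational matrix acts on `x ⊗ 1` through `x`: `(P ⊗ 1)·(x ⊗ 1) = (P x) ⊗ 1` (the diagonal embedding `GL_n(L) → GL_n(𝔸_{L,f})`
is compatible with the one of `Lⁿ`). [cite: CasselsFrohlichANT1967, Ch. II §14] [cite: PlatonovRapinchuk1994, §5.1] -/
theorem map_mulVec_adelicVecFin {n : ℕ} (P : Matrix (Fin n) (Fin n) L) (x : Fin n → L) :
    P.map (algebraMap L (FiniteAdeleRing (𝓞 L) L)) *ᵥ adelicVecFin L x = adelicVecFin L (P *ᵥ x) := by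
  funext i
  exact (RingHom.map_mulVec (algebraMap L (FiniteAdeleRing (𝓞 L) L)) P x i).symm

omit [NumberField L] [IsCMField L] in
/-- `⟨x - y, v⟩ = ⟨x, v⟩ - ⟨y, v⟩`. [folklore] -/
private theorem hermForm_sub_left {n : ℕ} (σ : L →+* L) (H : Matrix (Fin n) (Fin n) L) (x y v : Fin n → L) :
    hermForm σ H (x - y) v = hermForm σ H x v - hermForm σ H y v := by
  simp only [hermForm]
  rw [← sub_dotProduct]
  congr 1
  funext i
  simp

omit [NumberField L] [IsCMField L] in
/-- `⟨a • x, v⟩ = σ(a)·⟨x, v⟩`. [folklore] -/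
private theorem hermForm_smul_left {n : ℕ} (σ : L →+* L) (H : Matrix (Fin n) (Fin n) L) (a : L) (x v : Fin n → L) :
    hermForm σ H (a • x) v = σ a * hermForm σ H x v := by
  simp only [hermForm]
  rw [← smul_eq_mul, ← smul_dotProduct]
  congr 1
  funext i
  simp

/-! ### §1. Uniqueness and quotients of diagonal twists -/

variable {L}
variable (Jstar : Matrix (Fin 2) (Fin 2) L)

/-- **A diagonal twist is determined by its eigenvalue**: two elements of `U(J⋆)(𝔸_{L⁺,f})` multiplying `w ⊗ 1` by the same `t`
and fixing `w^⊥` pointwise coincide (`⟨w,w⟩ ≠ 0`: every `y ∈ L²` is `a·w + (y - a·w)` with `y - a·w ⊥ w`, and the `e_j ⊗ 1` span).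
Rank-2 copy of ★ `isDiagTwist_unique`. [cite: Milne2005ShimuraVarieties, Def. 12.5 p. 113] -/
theorem isDiagTwistGS_unique {w : Fin 2 → L} (hw : hermForm (cmConjRingHom L) Jstar w w ≠ 0) {t : FiniteAdeleRing (𝓞 L) L}
    {d d' : finAdelic (↥(maximalRealSubfield L)) L (IsCMField.complexConj L) 2 Jstar}
    (hd : IsDiagTwistGS L Jstar w t d) (hd' : IsDiagTwistGS L Jstar w t d') : d = d' := by
  set M : Matrix (Fin 2) (Fin 2) (FiniteAdeleRing (𝓞 L) L) :=
    ((d : GL (Fin 2) (FiniteAdeleRing (𝓞 L) L)) : Matrix (Fin 2) (Fin 2) (FiniteAdeleRing (𝓞 L) L)) with hM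
  set M' : Matrix (Fin 2) (Fin 2) (FiniteAdeleRing (𝓞 L) L) :=
    ((d' : GL (Fin 2) (FiniteAdeleRing (𝓞 L) L)) : Matrix (Fin 2) (Fin 2) (FiniteAdeleRing (𝓞 L) L)) with hM'
  have hagree : ∀ y : Fin 2 → L, M *ᵥ adelicVecFin L y = M' *ᵥ adelicVecFin L y := by
    intro y
    -- `y = a • w + (y - a • w)` with `y - a • w ⊥ w`
    set a : L := cmConjRingHom L (hermForm (cmConjRingHom L) Jstar y w * (hermForm (cmConjRingHom L) Jstar w w)⁻¹)
      with ha
    have hcc : ∀ z : L, cmConjRingHom L (cmConjRingHom L z) = z := fun z => by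
      rw [cmConjRingHom_apply, cmConjRingHom_apply]; exact IsCMField.complexConj_apply_apply L z
    have hca : cmConjRingHom L a = hermForm (cmConjRingHom L) Jstar y w * (hermForm (cmConjRingHom L) Jstar w w)⁻¹ := by
      rw [ha]; exact hcc _
    have hperp : hermForm (cmConjRingHom L) Jstar (y - a • w) w = 0 := by
      rw [hermForm_sub_left, hermForm_smul_left, hca, mul_assoc, inv_mul_cancel₀ hw, mul_one, sub_self]
    have hy : adelicVecFin L y = algebraMap L (FiniteAdeleRing (𝓞 L) L) a • adelicVecFin L w + adelicVecFin L (y - a • w) := by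
      rw [adelicVecFin_sub, adelicVecFin_smul, add_sub_cancel]
    rw [hy, mulVec_add, mulVec_add, mulVec_smul, mulVec_smul, hd.1, hd'.1, hd.2 _ hperp, hd'.2 _ hperp]
  have hMM : M = M' := by
    refine Matrix.ext fun i j => ?_
    have h := congrFun (hagree (Pi.single j 1)) i
    rw [adelicVecFin_single, Matrix.mulVec_single_one, Matrix.mulVec_single_one] at h
    simpa only [Matrix.col_apply] using h
  exact Subtype.ext (Units.ext hMM)

/-- **Quotient of two diagonal twists**: if `d` twists `w` by `t` and `d'` by `t'` with `t'·t'' = 1` (both fixing `w^⊥` pointwise),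
then `d·d'⁻¹` twists `w` by `t·t''`.  Rank-2 copy of ★ `IsDiagTwist.mul_inv`. [cite: Milne2005ShimuraVarieties, Def. 12.5 p. 113] -/
theorem IsDiagTwistGS.mul_inv {w : Fin 2 → L} {t t' t'' : FiniteAdeleRing (𝓞 L) L}
    {d d' : finAdelic (↥(maximalRealSubfield L)) L (IsCMField.complexConj L) 2 Jstar}
    (hd : IsDiagTwistGS L Jstar w t d) (hd' : IsDiagTwistGS L Jstar w t' d') (ht : t' * t'' = 1) :
    IsDiagTwistGS L Jstar w (t * t'') (d * d'⁻¹) := by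
  obtain ⟨hd1, hd2⟩ := hd
  obtain ⟨hd1', hd2'⟩ := hd'
  set M : Matrix (Fin 2) (Fin 2) (FiniteAdeleRing (𝓞 L) L) :=
    (((d : finAdelic (↥(maximalRealSubfield L)) L (IsCMField.complexConj L) 2 Jstar) :
      GL (Fin 2) (FiniteAdeleRing (𝓞 L) L)) : Matrix (Fin 2) (Fin 2) (FiniteAdeleRing (𝓞 L) L)) with hM
  set M' : Matrix (Fin 2) (Fin 2) (FiniteAdeleRing (𝓞 L) L) :=
    (((d' : finAdelic (↥(maximalRealSubfield L)) L (IsCMField.complexConj L) 2 Jstar) :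
      GL (Fin 2) (FiniteAdeleRing (𝓞 L) L)) : Matrix (Fin 2) (Fin 2) (FiniteAdeleRing (𝓞 L) L)) with hM'
  set N : Matrix (Fin 2) (Fin 2) (FiniteAdeleRing (𝓞 L) L) :=
    ((((d'⁻¹ : finAdelic (↥(maximalRealSubfield L)) L (IsCMField.complexConj L) 2 Jstar) :
      finAdelic (↥(maximalRealSubfield L)) L (IsCMField.complexConj L) 2 Jstar) :
      GL (Fin 2) (FiniteAdeleRing (𝓞 L) L)) : Matrix (Fin 2) (Fin 2) (FiniteAdeleRing (𝓞 L) L)) with hN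
  have hNM : N * M' = 1 := by
    rw [hN, hM', Subgroup.coe_inv, ← Units.val_mul, inv_mul_cancel, Units.val_one]
  have hinv : ∀ x : Fin 2 → FiniteAdeleRing (𝓞 L) L, N *ᵥ (M' *ᵥ x) = x := fun x => by
    rw [mulVec_mulVec, hNM, one_mulVec]
  have h1 : N *ᵥ adelicVecFin L w = t'' • adelicVecFin L w := by
    have h := hinv (t'' • adelicVecFin L w)
    rw [mulVec_smul, hd1', smul_smul, mul_comm, ht, one_smul] at h
    exact h
  have h2 : ∀ x : Fin 2 → L, hermForm (cmConjRingHom L) Jstar x w = 0 → N *ᵥ adelicVecFin L x = adelicVecFin L x := by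
    intro x hx
    have h := hinv (adelicVecFin L x)
    rw [hd2' x hx] at h
    exact h
  have hprod : ((((d * d'⁻¹ : finAdelic (↥(maximalRealSubfield L)) L (IsCMField.complexConj L) 2 Jstar) :
      finAdelic (↥(maximalRealSubfield L)) L (IsCMField.complexConj L) 2 Jstar) :
      GL (Fin 2) (FiniteAdeleRing (𝓞 L) L)) : Matrix (Fin 2) (Fin 2) (FiniteAdeleRing (𝓞 L) L)) = M * N := by
    rw [Subgroup.coe_mul, Units.val_mul]
  refine ⟨?_, fun x hx => ?_⟩
  · rw [hprod, ← mulVec_mulVec, h1, mulVec_smul, hd1, smul_smul, mul_comm]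
  · rw [hprod, ← mulVec_mulVec, h2 x hx, hd2 x hx]

/-! ### §2. A diagonal twist by a GLOBAL norm-one scalar is a rational element of `U(J⋆)(L⁺)` fixing the special point -/

omit [NumberField L] [IsCMField L] in
/-- The action of a quasi-reflection `1 + a · u ⊗ r` on a vector: `x + a ⟨r, x⟩ u`. [folklore] -/
private theorem one_add_smul_vecMulVec_mulVec (u r : Fin 2 → L) (a : L) (x : Fin 2 → L) :
    (1 + a • vecMulVec u r) *ᵥ x = x + (a * (r ⬝ᵥ x)) • u := by
  rw [add_mulVec, one_mulVec, smul_mulVec, vecMulVec_mulVec]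
  ext i
  simp only [Pi.add_apply, Pi.smul_apply, MulOpposite.smul_eq_mul_unop, MulOpposite.unop_op, smul_eq_mul]
  ring

omit [NumberField L] [IsCMField L] in
/-- Composition of two quasi-reflections along one vector. [folklore] -/
private theorem one_add_smul_vecMulVec_mul (u r : Fin 2 → L) (a b : L) :
    (1 + a • vecMulVec u r) * (1 + b • vecMulVec u r) = 1 + (a + b + a * b * (r ⬝ᵥ u)) • vecMulVec u r := by
  rw [add_mul, one_mul, mul_add, mul_one, Matrix.smul_mul, Matrix.mul_smul, vecMulVec_mul_vecMulVec, vecMulVec_smul,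
    smul_smul, smul_smul]
  module

/-- **The rational diagonal twist on the curve datum**: for `J⋆` hermitian (`c(J⋆ᵢⱼ) = J⋆ⱼᵢ`), `⟨w,w⟩ ≠ 0` and `z ∈ L` with
`z·c(z) = 1` there is `γ ∈ U(J⋆)(L⁺)` (the tree's `rational`) whose image in `U(J⋆)(𝔸_{L⁺,f})` is THE diagonal twist at `w` by
`z ⊗ 1` (★ `IsDiagTwistGS`) and which multiplies `τw` by `τ(z)` — the RATIONAL point
`γ = 1 + ((z−1)/⟨w,w⟩) w ⊗ ⟨w,·⟩` of the torus `T = U(L·w) × U(w^⊥)` at the special point ([Milne2005ShimuraVarieties] Def. 12.5: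
`T(ℚ)` fixes `x`).  Rank-2 copy of ★ `exists_rational_isDiagTwist_algebraMap`.
[cite: Milne2005ShimuraVarieties, Def. 12.5 and Rem. 12.6 p. 113] -/
theorem exists_rational_isDiagTwistGS_algebraMap (hJ : ∀ i j, cmConjRingHom L (Jstar i j) = Jstar j i) (τ : L →+* ℂ)
    {w : Fin 2 → L} (hw : hermForm (cmConjRingHom L) Jstar w w ≠ 0) {z : L} (hz : z * cmConjRingHom L z = 1) :
    ∃ γ : rational (↥(maximalRealSubfield L)) L (IsCMField.complexConj L) 2 Jstar,
      IsDiagTwistGS L Jstar w (algebraMap L (FiniteAdeleRing (𝓞 L) L) z)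
          (rationalToFinAdelic (↥(maximalRealSubfield L)) L (IsCMField.complexConj L) 2 Jstar γ) ∧
        ((ratToGLℂ L Jstar τ γ : GL (Fin 2) ℂ) : Matrix (Fin 2) (Fin 2) ℂ) *ᵥ (fun i => τ (w i)) = τ z • fun i => τ (w i) := by
  have hcc : ∀ y : L, cmConjRingHom L (cmConjRingHom L y) = y := fun y => by
    rw [cmConjRingHom_apply, cmConjRingHom_apply]; exact IsCMField.complexConj_apply_apply L y
  -- notation: `h = ⟨w,w⟩`, the row `ρ = ⟨w, ·⟩`, the coefficients `a = (z-1)/h`, `a' = (c z - 1)/h`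
  set h : L := hermForm (cmConjRingHom L) Jstar w w with hh
  set ρ : Fin 2 → L := (cmConjRingHom L ∘ w) ᵥ* Jstar with hρ
  have hρv : ρ ⬝ᵥ w = h := by rw [hh, hρ]; exact (dotProduct_mulVec _ _ _).symm
  have hρw : ∀ x : Fin 2 → L, hermForm (cmConjRingHom L) Jstar x w = 0 → ρ ⬝ᵥ x = 0 := fun x hx => by
    rw [hρ, ← dotProduct_mulVec]
    change hermForm (cmConjRingHom L) Jstar w x = 0
    rw [hermForm_conj_symm L Jstar hJ, hx, map_zero]
  have hch : cmConjRingHom L h = h := conj_hermForm_self_eq L Jstar hJ w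
  set a : L := (z - 1) * h⁻¹ with ha
  set a' : L := (cmConjRingHom L z - 1) * h⁻¹ with ha'
  have hca : cmConjRingHom L a = a' := by rw [ha, ha', map_mul, map_sub, map_one, map_inv₀, hch]
  have hkey : a + a' + a * a' * h = 0 := by
    rw [ha, ha']
    field_simp
    linear_combination hz
  have hkey' : a' + a + a' * a * h = 0 := by linear_combination hkey
  set P : Matrix (Fin 2) (Fin 2) L := 1 + a • vecMulVec w ρ with hP
  set P' : Matrix (Fin 2) (Fin 2) L := 1 + a' • vecMulVec w ρ with hP'
  have hPP' : P * P' = 1 := by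
    rw [hP, hP', one_add_smul_vecMulVec_mul, hρv, hkey, zero_smul, add_zero]
  have hP'P : P' * P = 1 := by
    rw [hP, hP', one_add_smul_vecMulVec_mul, hρv, hkey', zero_smul, add_zero]
  -- action on `w` and on `w^⊥`
  have hPv : P *ᵥ w = z • w := by
    rw [hP, one_add_smul_vecMulVec_mulVec, hρv]
    have : a * h = z - 1 := by rw [ha]; field_simp
    rw [this]
    ext i
    simp only [Pi.add_apply, Pi.smul_apply, smul_eq_mul]
    ring
  have hPw : ∀ x : Fin 2 → L, hermForm (cmConjRingHom L) Jstar x w = 0 → P *ᵥ x = x := fun x hx => by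
    rw [hP, one_add_smul_vecMulVec_mulVec, hρw x hx, mul_zero, zero_smul, add_zero]
  -- unitarity `(c P)ᵀ J⋆ P = J⋆`
  have hρc : ∀ j, cmConjRingHom L (ρ j) = (Jstar *ᵥ w) j := fun j => by
    simp only [hρ, vecMul, dotProduct, Function.comp_apply, map_sum, map_mul, hcc, hJ, mulVec]
    refine Finset.sum_congr rfl fun i _ => ?_
    ring
  have hPc : (P.map (cmConjRingHom L))ᵀ = 1 + a' • vecMulVec (Jstar *ᵥ w) (cmConjRingHom L ∘ w) := by
    rw [hP, Matrix.map_add _ (map_add _), Matrix.map_one _ (map_zero _) (map_one _), transpose_add,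
      transpose_one]
    congr 1
    ext i j
    simp only [transpose_apply, Matrix.map_apply, Matrix.smul_apply, vecMulVec_apply, smul_eq_mul, map_mul, hca,
      hρc, Function.comp_apply]
    ring
  have hunit : (P.map (cmConjRingHom L))ᵀ * Jstar * P = Jstar := by
    rw [hPc, add_mul, one_mul, Matrix.smul_mul, vecMulVec_mul, ← hρ, hP]
    rw [mul_add, mul_one, Matrix.mul_smul, add_mul, Matrix.smul_mul, mul_vecMulVec, vecMulVec_mul_vecMulVec, hρv,
      vecMulVec_smul]
    match_scalars
    · ring
    · linear_combination hkey
  -- the rational element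
  let γ₀ : GL (Fin 2) L := ⟨P, P', hPP', hP'P⟩
  have hγ₀ : γ₀ ∈ rational (↥(maximalRealSubfield L)) L (IsCMField.complexConj L) 2 Jstar := hunit
  refine ⟨⟨γ₀, hγ₀⟩, ⟨?_, fun x hx => ?_⟩, ?_⟩
  · -- `(P ⊗ 1)(w ⊗ 1) = (z ⊗ 1)(w ⊗ 1)`
    change (P.map (algebraMap L (FiniteAdeleRing (𝓞 L) L))) *ᵥ adelicVecFin L w = _
    rw [map_mulVec_adelicVecFin, hPv, adelicVecFin_smul]
  · change (P.map (algebraMap L (FiniteAdeleRing (𝓞 L) L))) *ᵥ adelicVecFin L x = _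
    rw [map_mulVec_adelicVecFin, hPw x hx]
  · -- `γ^τ (τ w) = τ(z) · τ w`
    rw [coe_ratToGLℂ]
    change P.map τ *ᵥ (fun i => τ (w i)) = _
    funext i
    have h1 := (RingHom.map_mulVec τ P w i).symm
    rw [hPv] at h1
    change (P.map τ *ᵥ (τ ∘ w)) i = _
    rw [h1, Pi.smul_apply, Pi.smul_apply, smul_eq_mul, smul_eq_mul, map_mul]

/-- **A diagonal twist by a global norm-one scalar acts trivially on `Sh_K(U(J⋆))(ℂ)` at the special point `[τw]`**: if
`g ∈ U(J⋆)(𝔸_{L⁺,f})` twists `w` by `z ⊗ 1` with `z ∈ L`, `z·c(z) = 1`, then `[τw, g·aK] = [τw, aK]` for every `a` and every level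
`K` — `g = γ_z ⊗ 1` for the rational `γ_z` of `exists_rational_isDiagTwistGS_algebraMap`, and `τ(z)·γ_z^τ(τw)`-invariance of the class
(★ `ShimuraSetGS.mk_smul_mulVec`).  Rank-2 copy of ★ `shimuraSet_mk_mul_eq_of_isDiagTwist_algebraMap`.
[cite: Milne2005ShimuraVarieties, Def. 12.5 p. 113 and Lemma 5.13 p. 57] -/
theorem shimuraSetGS_mk_mul_eq_of_isDiagTwistGS_algebraMap (hJ : ∀ i j, cmConjRingHom L (Jstar i j) = Jstar j i)
    (τ : L →+* ℂ) (K : Subgroup (finAdelic (↥(maximalRealSubfield L)) L (IsCMField.complexConj L) 2 Jstar))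
    {w : Fin 2 → L} (hw : hermForm (cmConjRingHom L) Jstar w w ≠ 0) (hwτ : (fun i => τ (w i)) ∈ negCone (Jstar.map τ))
    {z : L} (hz : z * cmConjRingHom L z = 1) {g : finAdelic (↥(maximalRealSubfield L)) L (IsCMField.complexConj L) 2 Jstar}
    (hg : IsDiagTwistGS L Jstar w (algebraMap L (FiniteAdeleRing (𝓞 L) L) z) g)
    (a : finAdelic (↥(maximalRealSubfield L)) L (IsCMField.complexConj L) 2 Jstar) :
    ShimuraSetGS.mk L Jstar τ K (fun i => τ (w i)) hwτ (g * a) = ShimuraSetGS.mk L Jstar τ K (fun i => τ (w i)) hwτ a := by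
  obtain ⟨γ, hγ, hγw⟩ := exists_rational_isDiagTwistGS_algebraMap Jstar hJ τ hw hz
  have hγg : rationalToFinAdelic (↥(maximalRealSubfield L)) L (IsCMField.complexConj L) 2 Jstar γ = g :=
    isDiagTwistGS_unique Jstar hw hγ hg
  have hz0 : z ≠ 0 := by
    rintro rfl
    rw [zero_mul] at hz
    exact zero_ne_one hz
  have hτz : τ z ≠ 0 := (map_ne_zero τ).2 hz0
  -- `[τw, γ a K] = [(τ z)⁻¹ • γ^τ (τ w), γ a K] = [τ w, aK]`
  have hfix : (τ z)⁻¹ • (((ratToGLℂ L Jstar τ γ : GL (Fin 2) ℂ) : Matrix (Fin 2) (Fin 2) ℂ) *ᵥ fun i => τ (w i)) =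
      fun i => τ (w i) := by
    rw [hγw, smul_smul, inv_mul_cancel₀ hτz, one_smul]
  have hmem : (τ z)⁻¹ • (((ratToGLℂ L Jstar τ γ : GL (Fin 2) ℂ) : Matrix (Fin 2) (Fin 2) ℂ) *ᵥ fun i => τ (w i)) ∈
      negCone (Jstar.map τ) := by
    rw [hfix]; exact hwτ
  have h := ShimuraSetGS.mk_smul_mulVec L Jstar τ K γ (inv_ne_zero hτz) (fun i => τ (w i)) hwτ hmem a
  rw [hγg] at h
  rw [← h]
  congr 1
  exact hfix.symm

/-! ### §3. The twist class is independent of the Artin correspondent -/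

variable (L)

/-- **Shimura reciprocity's twist `[τw, r(s)·aK]` on the unitary Shimura curve depends only on `σ`, not on the chosen Artin
correspondent `s`**: if `s, s' ∈ (𝔸_{L,f})^×` both satisfy `art_L(·) = σ|_{L^{ab}}` along `τ` (★ `IsArtinCorrespondent`) and `d, d'`
are the diagonal twists at `w` by `r(s) = c(s)/s`, `r(s') = c(s')/s'` (★ `recipFactor`, ★ `IsDiagTwistGS`), then
`[τw, d·aK] = [τw, d'·aK]` in `Sh_K(U(J⋆), 𝔻)(ℂ)` for every `a` and every `K`.  Proof: `[(1,s), L] = [(1,s'), L]`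
(★ `ideleArtinMap_eq_of_isArtinCorrespondent`), so `k = s/s'` lies in `closure(L^×)` (★ `mem_closure_range_unitEmbedding_of_ideleArtinMap_eq_one`,
[Shimura1998] §18.3), so `r(k) = z ⊗ 1` is a GLOBAL norm-one scalar (★ `exists_recipFactor_eq_algebraMap_of_mem_closure`, Kronecker),
and `d·d'⁻¹` is the twist by `z ⊗ 1` (§1), which acts trivially (§2).  Rank-2 copy of ★ `shimuraSet_mk_twist_eq_of_isArtinCorrespondent`;
it converts a reciprocity law proved for ONE correspondent (e.g. `N_{E♯/L} s♯`) into the law for ALL (e.g. the `L`-idèle of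
`AuxChartGS.f_recip`). [cite: Milne2005ShimuraVarieties, Def. 12.8 (62) p. 114] [cite: Shimura1998, §18.3 p. 122] -/
theorem shimuraSetGS_mk_twist_eq_of_isArtinCorrespondent (hJ : ∀ i j, cmConjRingHom L (Jstar i j) = Jstar j i)
    (τ : L →+* ℂ) (K : Subgroup (finAdelic (↥(maximalRealSubfield L)) L (IsCMField.complexConj L) 2 Jstar)) {σ : ℂ ≃+* ℂ}
    {s s' : (FiniteAdeleRing (𝓞 L) L)ˣ} (hs : IsArtinCorrespondent L τ s σ) (hs' : IsArtinCorrespondent L τ s' σ)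
    {w : Fin 2 → L} (hw : hermForm (cmConjRingHom L) Jstar w w ≠ 0) (hwτ : (fun i => τ (w i)) ∈ negCone (Jstar.map τ))
    {d d' : finAdelic (↥(maximalRealSubfield L)) L (IsCMField.complexConj L) 2 Jstar}
    (hd : IsDiagTwistGS L Jstar w (recipFactor L s) d) (hd' : IsDiagTwistGS L Jstar w (recipFactor L s') d')
    (a : finAdelic (↥(maximalRealSubfield L)) L (IsCMField.complexConj L) 2 Jstar) :
    ShimuraSetGS.mk L Jstar τ K (fun i => τ (w i)) hwτ (d * a) = ShimuraSetGS.mk L Jstar τ K (fun i => τ (w i)) hwτ (d' * a) := by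
  set ι : (FiniteAdeleRing (𝓞 L) L)ˣ →* ideleGroup L :=
    Units.map (MonoidHom.inr (InfiniteAdeleRing L) (FiniteAdeleRing (𝓞 L) L) :
      FiniteAdeleRing (𝓞 L) L →* AdeleRing (𝓞 L) L) with hι
  -- `k = s/s'` is killed by the Artin map, hence lies in `closure(L^×)`
  have hk : ideleArtinMap L (ι (s * s'⁻¹)) = 1 := by
    have h1 : ι (s * s'⁻¹) = ι s * (ι s')⁻¹ := by rw [map_mul, map_inv]
    have h2 : ideleArtinMap L (ι s) = ideleArtinMap L (ι s') := ideleArtinMap_eq_of_isArtinCorrespondent L τ hs hs'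
    rw [h1, (ideleArtinMap L).map_mul, (ideleArtinMap L).map_inv, h2, mul_inv_cancel]
  have hcl := mem_closure_range_unitEmbedding_of_ideleArtinMap_eq_one L (s * s'⁻¹) hk
  -- so `r(k) = z ⊗ 1` with `z c(z) = 1`
  obtain ⟨z, hz, hzk⟩ := exists_recipFactor_eq_algebraMap_of_mem_closure L (s * s'⁻¹) hcl
  -- `d d'⁻¹` is the twist by `r(k)`
  have hdd : IsDiagTwistGS L Jstar w (algebraMap L (FiniteAdeleRing (𝓞 L) L) z) (d * d'⁻¹) := by
    rw [← hzk, recipFactor_mul_inv]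
    exact hd.mul_inv Jstar hd' (recipFactor_mul_conj s')
  have h := shimuraSetGS_mk_mul_eq_of_isDiagTwistGS_algebraMap Jstar hJ τ K hw hwτ hz hdd (d' * a)
  rwa [mul_assoc, inv_mul_cancel_left] at h

/-- The same with the hermitian hypothesis in TRANSPOSE form `ᵗ(c J⋆) = J⋆` (the binder shape of the E-line `stub_E123` and of
★ `exists_isDiagTwistGS_recipFactor'`). [cite: Milne2005ShimuraVarieties, Def. 12.8 (62) p. 114] -/
theorem shimuraSetGS_mk_twist_eq_of_isArtinCorrespondent' (hJ : (Jstar.map (IsCMField.complexConj L))ᵀ = Jstar)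
    (τ : L →+* ℂ) (K : Subgroup (finAdelic (↥(maximalRealSubfield L)) L (IsCMField.complexConj L) 2 Jstar)) {σ : ℂ ≃+* ℂ}
    {s s' : (FiniteAdeleRing (𝓞 L) L)ˣ} (hs : IsArtinCorrespondent L τ s σ) (hs' : IsArtinCorrespondent L τ s' σ)
    {w : Fin 2 → L} (hw : hermForm (cmConjRingHom L) Jstar w w ≠ 0) (hwτ : (fun i => τ (w i)) ∈ negCone (Jstar.map τ))
    {d d' : finAdelic (↥(maximalRealSubfield L)) L (IsCMField.complexConj L) 2 Jstar}
    (hd : IsDiagTwistGS L Jstar w (recipFactor L s) d) (hd' : IsDiagTwistGS L Jstar w (recipFactor L s') d')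
    (a : finAdelic (↥(maximalRealSubfield L)) L (IsCMField.complexConj L) 2 Jstar) :
    ShimuraSetGS.mk L Jstar τ K (fun i => τ (w i)) hwτ (d * a) = ShimuraSetGS.mk L Jstar τ K (fun i => τ (w i)) hwτ (d' * a) :=
  shimuraSetGS_mk_twist_eq_of_isArtinCorrespondent L Jstar (conj_apply_eq_of_transpose_map_eq L Jstar hJ) τ K hs hs' hw hwτ
    hd hd' a

end UnitaryCanonicalModel

end Literature.AlgebraicGeometry.ShimuraVarieties

end
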